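import Summits.NavierStokesRegularity.NavierStokesRegularity.Theorems.ExtremiserTransienceNearExtremalTransienceSharpConstant
import Literature.Analysis.FluidPDE.FlatSwirlGauge
import Literature.Analysis.FluidPDE.SpaceTimeRescaling
import HarnessLib

/-!
# Route `ExtremiserTransience`, crux `NearExtremalTransience` (stmt-NavierStokesRegularity-21883):
# SCALE COVARIANCE OF THE DEPLETION FUNCTIONAL and LOG-PERIODICITY OF THE EFFICIENCY ALONG DSS FLOWS

`--supports stmt-NavierStokesRegularity-21883` (route-independent: no `Theses` import). Author: prover seat
`ns-et-p1` (g2). Infrastructure for the crux's BC5 stratum (discretely self-similar Type-I flows) and for the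
variational problem behind the sharp constant `κ⋆`.

§1. Under the Navier–Stokes scaling of a slice, `v_c = nsRescaleData c v : x ↦ c·v(cx)` (`c > 0`), the four
data of the depletion inequality scale as
`curl v_c = c² (curl v)(c·)`, `D(curl v_c) = c³ (D curl v)(c·)`, `‖curl v_c‖₂² = c‖curl v‖₂²`,
`‖∇curl v_c‖₂² = c³‖∇curl v‖₂²`, `∫⟪curl v_c, Dv_c curl v_c⟫ = c³ ∫⟪curl v, Dv curl v⟫`, `sup|v_c| = c·sup|v|`
(`curl_nsRescaleData`, `fderiv_nsRescaleData`, `fderiv_curl_nsRescaleData`, `integral_norm_curl_sq_nsRescaleData`,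
`integral_frobeniusNormSq_fderiv_curl_nsRescaleData`, `integral_stretching_nsRescaleData`,
`forall_norm_nsRescaleData_le_iff`); hence **the flow-wise depletion clause with a given coefficient value `k` is
scale invariant** (`depletionClause_nsRescaleData_iff`): the stretching efficiency
`R[v] = |∫⟪ω, Dv ω⟫|/(sup|v|·‖ω‖₂·‖∇ω‖₂)` is dimensionless, `R[v_c] = R[v]`.

§2. Along a flow that is **discretely self-similar about the time `T`** with factor `c > 1`
(`IsDiscretelySelfSimilar c (fun s x => u (T + s) x)`, the hypothesis of the crux's BC5 rung), the slices satisfy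
`u(T − σ) = (u(T − c²σ))_c` (`slice_eq_nsRescaleData_of_dss`), so every MINIMAL flow-wise coefficient — the
efficiency `R(t)` — is **log-periodic**: `k₀(T − σ) = k₀(T − c²σ)` whenever both times lie in `[0,T)`
(`minimalCoeff_logPeriodic_of_dss`).

WHAT THIS IS NOT: nothing dynamic about non-self-similar flows; no bound on `R` beyond the landed constants; the
crux, its BC5 rung, the route and the summit stay open; Navier–Stokes regularity is NOT proved. [folklore]
-/

noncomputable section

open Set Filter Topology MeasureTheory
open scoped InnerProductSpace RealInnerProductSpace ENNReal NNReal ContDiff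
open Literature.Analysis.FluidPDE

namespace Summit.NavierStokesRegularity.NavierStokesRegularity.Theorems

-- the problem directory repeats the summit name (`NavierStokesRegularity/NavierStokesRegularity`)
set_option linter.dupNamespace false

namespace DepletionLadder

/-! ## §1 Scale covariance of the depletion data -/

/-- `curl (x ↦ c·v(cx)) = c²·(curl v)(c·)` (chain rule; no differentiability hypothesis, both sides share the
junk value). [folklore] -/
theorem curl_nsRescaleData (c : ℝ) (v : EuclideanSpace ℝ (Fin 3) → EuclideanSpace ℝ (Fin 3))
    (x : EuclideanSpace ℝ (Fin 3)) :
    curl (nsRescaleData c v) x = c ^ 2 • curl v (c • x) := by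
  have h : nsRescaleData c v = fun y => c • v (c • y) := rfl
  rw [h, curl_smul_comp_smul, ← pow_two]

/-- `D(x ↦ c·v(cx)) = c²·(Dv)(c·)`. [folklore] -/
theorem fderiv_nsRescaleData (c : ℝ) (v : EuclideanSpace ℝ (Fin 3) → EuclideanSpace ℝ (Fin 3))
    (x : EuclideanSpace ℝ (Fin 3)) :
    fderiv ℝ (nsRescaleData c v) x = c ^ 2 • fderiv ℝ v (c • x) := by
  have h : nsRescaleData c v = fun y => c • v (c • y) := rfl
  rw [h, fderiv_const_smul_comp_smul_apply, ← pow_two]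

/-- `D curl (x ↦ c·v(cx)) = c³·(D curl v)(c·)`. [folklore] -/
theorem fderiv_curl_nsRescaleData (c : ℝ) (v : EuclideanSpace ℝ (Fin 3) → EuclideanSpace ℝ (Fin 3))
    (x : EuclideanSpace ℝ (Fin 3)) :
    fderiv ℝ (curl (nsRescaleData c v)) x = c ^ 3 • fderiv ℝ (curl v) (c • x) := by
  have h : curl (nsRescaleData c v) = fun y => c ^ 2 • curl v (c • y) := funext (curl_nsRescaleData c v)
  rw [h, fderiv_const_smul_comp_smul_apply, ← pow_succ]

/-- Change of variables `x ↦ cx` on `ℝ³`, `c > 0`: `∫ f(cx) dx = c⁻³ ∫ f` (Mathlib's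
`Measure.integral_comp_smul`; valid with the Bochner junk value). [folklore] -/
theorem integral_comp_smul_three {c : ℝ} (hc : 0 < c) (f : EuclideanSpace ℝ (Fin 3) → ℝ) :
    ∫ x, f (c • x) = (c ^ 3)⁻¹ * ∫ x, f x := by
  have h := Measure.integral_comp_smul (volume : Measure (EuclideanSpace ℝ (Fin 3))) f c
  rw [finrank_euclideanSpace_fin, abs_of_nonneg (inv_nonneg.2 (pow_nonneg hc.le 3)), smul_eq_mul] at h
  exact h

/-- **Enstrophy scales like `c`**: `‖curl v_c‖₂² = c·‖curl v‖₂²` for `v_c = c·v(c·)`, `c > 0`. [folklore] -/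
theorem integral_norm_curl_sq_nsRescaleData {c : ℝ} (hc : 0 < c)
    (v : EuclideanSpace ℝ (Fin 3) → EuclideanSpace ℝ (Fin 3)) :
    ∫ x, ‖curl (nsRescaleData c v) x‖ ^ 2 = c * ∫ x, ‖curl v x‖ ^ 2 := by
  have hpt : ∀ x, ‖curl (nsRescaleData c v) x‖ ^ 2 = c ^ 4 * (fun y => ‖curl v y‖ ^ 2) (c • x) := by
    intro x
    rw [curl_nsRescaleData, norm_smul, Real.norm_eq_abs, abs_of_nonneg (by positivity), mul_pow]
    ring
  simp_rw [hpt]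
  rw [integral_const_mul, show (∫ x, ‖curl v (c • x)‖ ^ 2) = (c ^ 3)⁻¹ * ∫ x, ‖curl v x‖ ^ 2 from
    integral_comp_smul_three hc (fun y => ‖curl v y‖ ^ 2)]
  field_simp

/-- **Palinstrophy scales like `c³`**: `‖∇curl v_c‖₂² = c³·‖∇curl v‖₂²`, `c > 0`. [folklore] -/
theorem integral_frobeniusNormSq_fderiv_curl_nsRescaleData {c : ℝ} (hc : 0 < c)
    (v : EuclideanSpace ℝ (Fin 3) → EuclideanSpace ℝ (Fin 3)) :
    ∫ x, frobeniusNormSq (fderiv ℝ (curl (nsRescaleData c v)) x) =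
      c ^ 3 * ∫ x, frobeniusNormSq (fderiv ℝ (curl v) x) := by
  have hpt : ∀ x, frobeniusNormSq (fderiv ℝ (curl (nsRescaleData c v)) x) =
      c ^ 6 * (fun y => frobeniusNormSq (fderiv ℝ (curl v) y)) (c • x) := by
    intro x
    rw [fderiv_curl_nsRescaleData, frobeniusNormSq_smul]
    ring
  simp_rw [hpt]
  rw [integral_const_mul, show (∫ x, frobeniusNormSq (fderiv ℝ (curl v) (c • x))) =
    (c ^ 3)⁻¹ * ∫ x, frobeniusNormSq (fderiv ℝ (curl v) x) from
    integral_comp_smul_three hc (fun y => frobeniusNormSq (fderiv ℝ (curl v) y))]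
  field_simp

/-- **The stretching integral scales like `c³`**: `∫⟪curl v_c, Dv_c curl v_c⟫ = c³ ∫⟪curl v, Dv curl v⟫`,
`c > 0`. [folklore] -/
theorem integral_stretching_nsRescaleData {c : ℝ} (hc : 0 < c)
    (v : EuclideanSpace ℝ (Fin 3) → EuclideanSpace ℝ (Fin 3)) :
    ∫ x, ⟪curl (nsRescaleData c v) x, fderiv ℝ (nsRescaleData c v) x (curl (nsRescaleData c v) x)⟫_ℝ =
      c ^ 3 * ∫ x, ⟪curl v x, fderiv ℝ v x (curl v x)⟫_ℝ := by
  have hpt : ∀ x, ⟪curl (nsRescaleData c v) x, fderiv ℝ (nsRescaleData c v) x (curl (nsRescaleData c v) x)⟫_ℝ =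
      c ^ 6 * (fun y => ⟪curl v y, fderiv ℝ v y (curl v y)⟫_ℝ) (c • x) := by
    intro x
    rw [curl_nsRescaleData, fderiv_nsRescaleData, FunLike.coe_smul, Pi.smul_apply, map_smul,
      real_inner_smul_left, real_inner_smul_right, real_inner_smul_right]
    ring
  simp_rw [hpt]
  rw [integral_const_mul, show (∫ x, ⟪curl v (c • x), fderiv ℝ v (c • x) (curl v (c • x))⟫_ℝ) =
    (c ^ 3)⁻¹ * ∫ x, ⟪curl v x, fderiv ℝ v x (curl v x)⟫_ℝ from
    integral_comp_smul_three hc (fun y => ⟪curl v y, fderiv ℝ v y (curl v y)⟫_ℝ)]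
  field_simp

/-- **The sup norm scales like `c`**: `M` bounds `|v_c|` iff `M/c` bounds `|v|` (`c > 0`). [folklore] -/
theorem forall_norm_nsRescaleData_le_iff {c : ℝ} (hc : 0 < c)
    (v : EuclideanSpace ℝ (Fin 3) → EuclideanSpace ℝ (Fin 3)) (M : ℝ) :
    (∀ x, ‖nsRescaleData c v x‖ ≤ M) ↔ ∀ x, ‖v x‖ ≤ M / c := by
  constructor
  · intro h y
    have hy := h (c⁻¹ • y)
    rw [nsRescaleData_apply, smul_inv_smul₀ hc.ne', norm_smul, Real.norm_eq_abs, abs_of_pos hc] at hy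
    rw [le_div_iff₀ hc, mul_comm]
    exact hy
  · intro h x
    rw [nsRescaleData_apply, norm_smul, Real.norm_eq_abs, abs_of_pos hc]
    have hx := h (c • x)
    rw [le_div_iff₀ hc] at hx
    linarith

/-- **Scale invariance of the flow-wise depletion clause.** For `c > 0` and any coefficient value `k`, the
clause «for every bound `M` of `|w|`, `|∫⟪curl w, Dw curl w⟫| ≤ k·M·‖curl w‖₂·‖∇curl w‖₂`» holds for `w = v_c`
iff it holds for `w = v`: the two sides scale by `c³` and `c·c^{1/2}·c^{3/2} = c³`. In particular the
stretching efficiency is dimensionless, `R[v_c] = R[v]`. [folklore] -/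
theorem depletionClause_nsRescaleData_iff {c : ℝ} (hc : 0 < c) (k : ℝ)
    (v : EuclideanSpace ℝ (Fin 3) → EuclideanSpace ℝ (Fin 3)) :
    (∀ M : ℝ, (∀ x, ‖nsRescaleData c v x‖ ≤ M) →
      |∫ x, ⟪curl (nsRescaleData c v) x, fderiv ℝ (nsRescaleData c v) x (curl (nsRescaleData c v) x)⟫_ℝ| ≤
        k * M * Real.sqrt (∫ x, ‖curl (nsRescaleData c v) x‖ ^ 2) *
          Real.sqrt (∫ x, frobeniusNormSq (fderiv ℝ (curl (nsRescaleData c v)) x))) ↔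
    (∀ M : ℝ, (∀ x, ‖v x‖ ≤ M) →
      |∫ x, ⟪curl v x, fderiv ℝ v x (curl v x)⟫_ℝ| ≤
        k * M * Real.sqrt (∫ x, ‖curl v x‖ ^ 2) * Real.sqrt (∫ x, frobeniusNormSq (fderiv ℝ (curl v) x))) := by
  set J : ℝ := ∫ x, ⟪curl v x, fderiv ℝ v x (curl v x)⟫_ℝ with hJ
  set Z : ℝ := ∫ x, ‖curl v x‖ ^ 2 with hZ
  set P : ℝ := ∫ x, frobeniusNormSq (fderiv ℝ (curl v) x) with hP
  have hZ0 : 0 ≤ Z := integral_nonneg fun x => sq_nonneg _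
  have hP0 : 0 ≤ P := integral_nonneg fun x => frobeniusNormSq_nonneg _
  have hJc := integral_stretching_nsRescaleData hc v
  have hZc := integral_norm_curl_sq_nsRescaleData hc v
  have hPc := integral_frobeniusNormSq_fderiv_curl_nsRescaleData hc v
  rw [hJc, hZc, hPc]
  have hsq : Real.sqrt (c * Z) * Real.sqrt (c ^ 3 * P) = c ^ 2 * (Real.sqrt Z * Real.sqrt P) := by
    have h3 : Real.sqrt (c ^ 3) = c * Real.sqrt c := by
      rw [show (c ^ 3 : ℝ) = c ^ 2 * c by ring, Real.sqrt_mul (pow_nonneg hc.le 2), Real.sqrt_sq hc.le]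
    have hcc : Real.sqrt c * Real.sqrt c = c := Real.mul_self_sqrt hc.le
    rw [Real.sqrt_mul hc.le, Real.sqrt_mul (pow_nonneg hc.le 3), h3]
    calc Real.sqrt c * Real.sqrt Z * (c * Real.sqrt c * Real.sqrt P)
        = c * (Real.sqrt c * Real.sqrt c) * (Real.sqrt Z * Real.sqrt P) := by ring
      _ = c ^ 2 * (Real.sqrt Z * Real.sqrt P) := by rw [hcc]; ring
  have habs : |c ^ 3 * J| = c ^ 3 * |J| := by
    rw [abs_mul, abs_of_pos (pow_pos hc 3)]
  constructor
  · intro h M hM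
    have hM' : ∀ x, ‖nsRescaleData c v x‖ ≤ c * M := by
      rw [forall_norm_nsRescaleData_le_iff hc]
      intro x; rw [mul_div_cancel_left₀ _ hc.ne']; exact hM x
    have h1 := h (c * M) hM'
    rw [habs, mul_assoc (k * (c * M)), hsq] at h1
    have h2 : c ^ 3 * |J| ≤ c ^ 3 * (k * M * Real.sqrt Z * Real.sqrt P) := by
      calc c ^ 3 * |J| ≤ k * (c * M) * (c ^ 2 * (Real.sqrt Z * Real.sqrt P)) := h1
        _ = c ^ 3 * (k * M * Real.sqrt Z * Real.sqrt P) := by ring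
    exact le_of_mul_le_mul_left h2 (pow_pos hc 3)
  · intro h M hM
    have hM' : ∀ x, ‖v x‖ ≤ M / c := (forall_norm_nsRescaleData_le_iff hc v M).1 hM
    have h1 := h (M / c) hM'
    rw [habs, mul_assoc (k * M), hsq]
    calc c ^ 3 * |J| ≤ c ^ 3 * (k * (M / c) * Real.sqrt Z * Real.sqrt P) :=
          mul_le_mul_of_nonneg_left h1 (pow_pos hc 3).le
      _ = k * M * (c ^ 2 * (Real.sqrt Z * Real.sqrt P)) := by
          have hc3 : c ^ 3 = c ^ 2 * c := by ring
          have hcM : c ^ 3 * (M / c) = c ^ 2 * M := by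
            rw [hc3, mul_assoc, ← mul_div_assoc, mul_div_cancel_left₀ M hc.ne']
          calc c ^ 3 * (k * (M / c) * Real.sqrt Z * Real.sqrt P)
              = k * (c ^ 3 * (M / c)) * (Real.sqrt Z * Real.sqrt P) := by ring
            _ = k * M * (c ^ 2 * (Real.sqrt Z * Real.sqrt P)) := by rw [hcM]; ring

/-! ## §2 Discretely self-similar flows: the efficiency is log-periodic -/

/-- Along a flow `u` that is discretely self-similar about the time `T` with factor `c`
(`nsRescale c (s ↦ u(T+s)) = (s ↦ u(T+s))`), the slice at `T − σ` is the `c`-rescaling of the slice at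
`T − c²σ`: `u(T − σ) = (x ↦ c·u(T − c²σ)(cx))`. [folklore] -/
theorem slice_eq_nsRescaleData_of_dss {c T : ℝ}
    {u : ℝ → EuclideanSpace ℝ (Fin 3) → EuclideanSpace ℝ (Fin 3)}
    (h : IsDiscretelySelfSimilar c (fun s x => u (T + s) x)) (σ : ℝ) :
    u (T - σ) = nsRescaleData c (u (T - c ^ 2 * σ)) := by
  funext x
  have h1 := congrFun (congrFun h (-σ)) x
  simp only [nsRescale_apply] at h1
  rw [nsRescaleData_apply, show T - c ^ 2 * σ = T + c ^ 2 * -σ by ring, h1, ← sub_eq_add_neg]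

/-- **Log-periodicity of minimal coefficients along DSS flows.** Let `u` be discretely self-similar about `T`
with factor `c > 0`, and let `k₀ ≥ 0` satisfy the flow-wise depletion clause at every `t ∈ [0,T)` and be
minimal there (below every nonnegative constant satisfying the clause at `t`). Then
`k₀(T − σ) = k₀(T − c²σ)` whenever `0 < σ` and `c²σ ≤ T`, `σ ≤ T` (both times in `[0,T)`): the clause at `T − σ`
is the clause at `T − c²σ` transported by the scaling (`depletionClause_nsRescaleData_iff`). [folklore] -/
theorem minimalCoeff_logPeriodic_of_dss {c T : ℝ} (hc : 0 < c)
    {u : ℝ → EuclideanSpace ℝ (Fin 3) → EuclideanSpace ℝ (Fin 3)}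
    (hdss : IsDiscretelySelfSimilar c (fun s x => u (T + s) x))
    {k₀ : ℝ → ℝ} (hk₀0 : ∀ τ, 0 ≤ k₀ τ)
    (hcl : ∀ t ∈ Ico 0 T, ∀ M : ℝ, (∀ x, ‖u t x‖ ≤ M) →
      |∫ x, ⟪curl (u t) x, fderiv ℝ (u t) x (curl (u t) x)⟫_ℝ| ≤
        k₀ t * M * Real.sqrt (∫ x, ‖curl (u t) x‖ ^ 2) *
          Real.sqrt (∫ x, frobeniusNormSq (fderiv ℝ (curl (u t)) x)))
    (hmin : ∀ t ∈ Ico 0 T, ∀ c : ℝ, 0 ≤ c →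
      (∀ M : ℝ, (∀ x, ‖u t x‖ ≤ M) →
        |∫ x, ⟪curl (u t) x, fderiv ℝ (u t) x (curl (u t) x)⟫_ℝ| ≤
          c * M * Real.sqrt (∫ x, ‖curl (u t) x‖ ^ 2) *
            Real.sqrt (∫ x, frobeniusNormSq (fderiv ℝ (curl (u t)) x))) → k₀ t ≤ c)
    {σ : ℝ} (hσ : 0 < σ) (hσT : σ ≤ T) (hσc : c ^ 2 * σ ≤ T) :
    k₀ (T - σ) = k₀ (T - c ^ 2 * σ) := by
  have hc2 : 0 < c ^ 2 * σ := mul_pos (pow_pos hc 2) hσ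
  have hta : T - σ ∈ Ico 0 T := ⟨by linarith, by linarith⟩
  have htb : T - c ^ 2 * σ ∈ Ico 0 T := ⟨by linarith, by linarith⟩
  have hslice := slice_eq_nsRescaleData_of_dss hdss σ
  refine le_antisymm ?_ ?_
  · -- the clause at `T − c²σ` with value `k₀(T − c²σ)` transports to `T − σ`
    refine hmin _ hta _ (hk₀0 _) ?_
    have h := (depletionClause_nsRescaleData_iff hc (k₀ (T - c ^ 2 * σ)) (u (T - c ^ 2 * σ))).2
      (hcl _ htb)
    rw [← hslice] at h
    exact h
  · -- the clause at `T − σ` with value `k₀(T − σ)` transports back to `T − c²σ`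
    refine hmin _ htb _ (hk₀0 _) ?_
    have h := hcl _ hta
    rw [hslice] at h
    exact (depletionClause_nsRescaleData_iff hc (k₀ (T - σ)) (u (T - c ^ 2 * σ))).1 h

end DepletionLadder

end Summit.NavierStokesRegularity.NavierStokesRegularity.Theorems

end
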